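import Summits.BirchSwinnertonDyer.BirchSwinnertonDyer.Theorems.SprungSharpFlatMainConjecture
import Summits.BirchSwinnertonDyer.BirchSwinnertonDyer.Theorems.SignedLowerHalvesSprungLowerHalfAtThreeKDotSplitRealLift
import Summits.BirchSwinnertonDyer.BirchSwinnertonDyer.Theorems.SignedLowerHalvesSprungLowerHalfAtThreeSprungPairOfModularity
import HarnessLib

/-!
# Route `SignedLowerHalves`, crux `SprungLowerHalfAtThree` (item stmt-BirchSwinnertonDyer-19003):
# the GLUE of the planned split (D24-2) in the kernel — crux 5 BY NAME from its four children
# K1 `SprungLowerDivisibilityAtThree` · K2 `SharpFlatRankZeroConverseAtThree` · K3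
# `SharpFlatCharValueRankZeroAllLevels` · S4 `SharpFlatPublishedInputsAtThree`
# (cell `bsd-ssimc`, seat `bsd-ssimc-k3c5-kdot-split` g3; `--supports … --as helper`, closes nothing)

PARTITION (cell bsd-ssimc): X8 (A8) — `p = 3` good supersingular, `a_3 = ±3` — all conductors, crux
5 at every analytic rank; proves-the-glue-of; closes NONE; 0 census moves; BSD is not proved.

## What this file proves

The tenure planner's split of record for crux 5 (bsd-ssimc-plan g24, D24-1/D24-2, to be carried in
route rev 13 after REPORT-kdot-2): `SprungLowerHalfAtThree ⟸ K1 ∧ K2 ∧ K3 ∧ S4` with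

* **K1** `SprungLowerDivisibilityAtThree` (crux) := on X8, `∀ •, SprungSharpFlatLowerDivisibility W p •`
  — the Eisenstein half (MC↓•) of Sprung 2012 Main Conj. 7.21 on the REAL `X^•(E/ℚ_∞)`, for every
  colour with `L^• ≠ 0` (Theorems-side `@[conjecture]` leaf `SprungSharpFlatMainConjecture.lean`,
  typed by bsd-littype-11, filed by this seat on GO D24-1 (a));
* **K2** `SharpFlatRankZeroConverseAtThree` (crux) := on X8, `Finite Sel_{p^∞}(E/ℚ) → L(E,1) ≠ 0`
  — (conv₀), the `hconv` binder of p470332 VERBATIM (OPEN at `(3, ±3)`);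
* **K3** `SharpFlatCharValueRankZeroAllLevels` (support) := the display of
  `Sprung2024.lem59_sharpFlatCharValue_rankZero` ((K•), Lemmas 5.5–5.9) with the single binder
  `W.IsSemistable (𝓞 ℚ) →` DELETED (all conductors; flag `Sp24-Kdot-beyond-squarefree`: in print for
  square-free `N`; the printed proofs do not use it — littype-11 line check 00:26Z; Ray–Sprung AIF 75
  (2025) p. 2343 attributes the formula without a conductor condition);
* **S4** `SharpFlatPublishedInputsAtThree` (support) := `Sprung2012.thm22_exists_isHondaSystem ∧
  Sprung2012.thm714_sharpFlatSelmerDual_finite_torsion ∧ ModularForms.nonempty_modularParametrizationData`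
  — HELD published inputs by name (Sprung 2012 Thm. 2.2, Thm. 1.2 = 7.14; modularity BCDT).

`sprungLowerHalfAtThree_of_kdotSplit : K1 → K2 → K3 → S4 → SprungLowerHalfAtThree` — the children
are taken as HYPOTHESES whose types are the planner's child statements verbatim (they are not yet
Theses decls; when rev 13 lands, the glue item's proof is this theorem applied to the four `_holds`
links / hypotheses). Proof (the planner's informal glue, D24-2): stub (A) by
`stub_sprungPair_of_modularParametrization` (S4's modularity conjunct; p417663/p453712); if
`Sel_{3^∞}(E/ℚ)` is infinite the datum `ξ = h = 0` (`chromaticDatum_of_not_finite_selmer`); else K2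
gives `L(E,1) ≠ 0`, the cyclotomic `(κ, γ)` and the place `v ∋ 3` are tree objects, the local lift `g`
is `sprungLocalLift_holds` (p473737), a Honda system comes from S4's `thm22`, both colours are non-zero
(Sprung 2012 Prop. 6.14, tree theorem `sharp_ne_zero_and_flat_ne_zero_of_entireLFunction_one_ne_zero`)
so colour ♭ qualifies, `D := Sprung2012.sharpFlatSelmerDualData …` is the real `X^♭`, K1 gives the
generator `gen` with `ι gen = ϖ·ι(L♭·h)`, S4's `thm714` gives cotorsion, K3 gives Kim's
Euler-characteristic unit. HONEST STATUS: CONDITIONAL on K1 (OPEN conjecture), K2 (OPEN), K3 (not in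
print as stated beyond square-free `N`), S4 (published named facts); closes nothing; 0 cells move.

References: [Sprung2012] Thm. 2.2, Thm. 1.2/7.14, Prop. 6.14, Def. 7.11, Main Conj. 7.21;
[Sprung2024] §5.2 Lemmas 5.5–5.9; [RaySprung2025] p. 2343; [BCDTJAMS2001] Thm. A;
[Sprung2017] Thm. 1.12.
-/

set_option autoImplicit false
-- justification: the mandated namespace `Summit.BirchSwinnertonDyer.BirchSwinnertonDyer.Theorems`
-- (single-conjunct summit, Sub = Summit) repeats a segment by design (D-0017).
set_option linter.dupNamespace false

noncomputable section

open scoped Classical MatrixGroups ModularForm NumberField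

open CongruenceSubgroup WeierstrassCurve NumberField IsDedekindDomain
  Literature.NumberTheory.EllipticCurves Literature.NumberTheory.EllipticCurves.ModularForms
  Literature.NumberTheory.EllipticCurves.Rank1Residual
  Literature.NumberTheory.EllipticCurves.Rank1Residual.Typed
  Literature.NumberTheory.EllipticCurves.Sprung2017 Literature.NumberTheory.EllipticCurves.Sprung2012
  Literature.NumberTheory.EllipticCurves.ZpExtension
  Summit.BirchSwinnertonDyer.Rank1Residual.Supersingular

namespace Summit.BirchSwinnertonDyer.BirchSwinnertonDyer.Theorems

section Glue

/-- The place of `ℚ` above a rational prime (going up along `ℤ → 𝓞 ℚ`). [folklore] -/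
private theorem exists_heightOneSpectrum_natCast_mem_rat'' (p : ℕ) (hp : p.Prime) :
    ∃ v : HeightOneSpectrum (𝓞 ℚ), (p : 𝓞 ℚ) ∈ v.asIdeal := by
  haveI hmax : (Ideal.span {(p : ℤ)}).IsMaximal :=
    PrincipalIdealRing.isMaximal_of_irreducible (Nat.prime_iff_prime_int.mp hp).irreducible
  obtain ⟨Q, hQmax, hQ⟩ := Ideal.exists_ideal_over_maximal_of_isIntegral (S := 𝓞 ℚ)
    (Ideal.span {(p : ℤ)}) (by
      rw [(RingHom.injective_iff_ker_eq_bot _).mp (algebraMap ℤ (𝓞 ℚ)).injective_int]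
      exact bot_le)
  have hpQ : (p : 𝓞 ℚ) ∈ Q := by
    have : (p : ℤ) ∈ Q.comap (algebraMap ℤ (𝓞 ℚ)) := by
      rw [hQ]; exact Ideal.mem_span_singleton_self _
    simpa [Ideal.mem_comap] using this
  have hQne : Q ≠ ⊥ := by
    intro hbot
    rw [hbot, Ideal.mem_bot] at hpQ
    exact hp.ne_zero (by exact_mod_cast hpQ)
  exact ⟨⟨Q, hQmax.isPrime, hQne⟩, hpQ⟩

/-- **Crux 5 `SprungLowerHalfAtThree` BY NAME from the four children of the planned split (D24-2).**
Hypotheses, each the planner's child statement verbatim: `hK1` = K1 `SprungLowerDivisibilityAtThree`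
(on X8, `∀ •, SprungSharpFlatLowerDivisibility W p •` — (MC↓•) on the real `X^•`, OPEN conjecture),
`hK2` = K2 `SharpFlatRankZeroConverseAtThree` ((conv₀) on X8, OPEN), `hK3` = K3
`SharpFlatCharValueRankZeroAllLevels` ((K•) = Sprung 2024 Lemmas 5.5–5.9 display WITHOUT the
square-free binder; not in print as stated beyond square-free `N`), `hS4` = S4
`SharpFlatPublishedInputsAtThree` (Sprung 2012 Thm. 2.2 ∧ Thm. 1.2/7.14 ∧ modularity, named facts).
Proof = the planner's informal glue (module docstring): stub (A) from modularity; Selmer infinite ⇒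
`ξ = 0`; else (conv₀) ⇒ `L(E,1) ≠ 0` ⇒ both colours non-zero (Prop. 6.14) ⇒ for colour ♭ the real
datum `sharpFlatSelmerDualData`, its generator from K1, cotorsion from Thm. 7.14, the unit from K3;
local lift `sprungLocalLift_holds` (PROVED). CONDITIONAL; closes nothing; 0 cells move.
[cite: Sprung2012, Thm. 2.2, Thm. 1.2, Prop. 6.14 and Main Conj. 7.21]
[cite: Sprung2024, §5.2 Lemmas 5.5–5.9] [cite: BCDTJAMS2001, Thm. A] -/
theorem sprungLowerHalfAtThree_of_kdotSplit
    (hK1 : ∀ (W : WeierstrassCurve ℚ) [W.IsElliptic] [W.IsGloballyMinimal] (p : ℕ) [Fact p.Prime],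
      ClassX8 W p → ∀ col : Chroma, SprungSharpFlatLowerDivisibility W p col)
    (hK2 : ∀ (W : WeierstrassCurve ℚ) [W.IsElliptic] [W.IsGloballyMinimal] (p : ℕ) [Fact p.Prime],
      ClassX8 W p → Finite (W.selmerGroupPInfty p) → W.entireLFunction 1 ≠ 0)
    (hK3 : ∀ (W : WeierstrassCurve ℚ) [W.IsElliptic] [W.IsGloballyMinimal] (p : ℕ) [Fact p.Prime],
      p ≠ 2 → W.HasGoodReductionAtPrime p → (p : ℤ) ∣ W.frobeniusTrace p →
      W.entireLFunction 1 ≠ 0 →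
      ∀ (κ : ZpExtension ℚ p) (γ : Field.absoluteGaloisGroup ℚ),
        κ.IsCyclotomic → κ.IsTopGenerator γ → IsCyclotomicVariable p γ →
      ∀ (v : HeightOneSpectrum (𝓞 ℚ)), (p : 𝓞 ℚ) ∈ v.asIdeal →
      ∀ (g : Field.absoluteGaloisGroup (v.adicCompletion ℚ)),
        κ.IsTopGenerator (resGalOfEmb (closureEmb (K := ℚ) (v.adicCompletion ℚ)) g) →
      ∀ (cneg : localPoints W (v.adicCompletion ℚ)) (c : ℕ → localPoints W (v.adicCompletion ℚ)),
        IsHondaSystem κ (closureEmb (K := ℚ) (v.adicCompletion ℚ)) W (W.frobeniusTrace p) g cneg c →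
      ∀ (col : Chroma)
        (D : SharpFlatSelmerDualData W κ γ (closureEmb (K := ℚ) (v.adicCompletion ℚ))
          (W.frobeniusTrace p) g c col) [Module.Finite (IwasawaAlgebra p) D.X],
        Module.IsTorsion (IwasawaAlgebra p) D.X →
      ∀ (f : IwasawaAlgebra p), D.charIdeal = Ideal.span {f} →
        Finite (W.selmerGroupPInfty p) →
        ∃ u : ℤ_[p]ˣ,
          ((PowerSeries.constantCoeff f : ℤ_[p]) : ℚ_[p]) =
            ((u : ℤ_[p]) : ℚ_[p]) * (p : ℚ_[p]) ^ (padicValNat p W.tamagawaProduct) *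
              (Nat.card (W.selmerGroupPInfty p) : ℚ_[p]))
    (hS4 : Sprung2012.thm22_exists_isHondaSystem ∧ Sprung2012.thm714_sharpFlatSelmerDual_finite_torsion ∧
      nonempty_modularParametrizationData) :
    Summit.BirchSwinnertonDyer.BirchSwinnertonDyer.Theses.SignedLowerHalves.SprungLowerHalfAtThree := by
  unfold Summit.BirchSwinnertonDyer.BirchSwinnertonDyer.Theses.SignedLowerHalves.SprungLowerHalfAtThree
  intro W _ _ p _ hX
  obtain ⟨h22, h714, hmodP⟩ := hS4
  -- stub (A): the real objects `(f, ϖ, L♯, L♭)` from modularity (p417663 / p453712)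
  obtain ⟨N, hN, f, ϖ, Lsharp, Lflat, hf, hϖ, hSP⟩ := stub_sprungPair_of_modularParametrization hmodP W p hX
  -- positive corank: `ξ = h = 0`
  by_cases hfin : Finite (W.selmerGroupPInfty p)
  swap
  · obtain ⟨ξ, hEC, h, hι⟩ := chromaticDatum_of_not_finite_selmer W p hfin ϖ (chromaticL .flat Lsharp Lflat)
    exact ⟨N, hN, f, ϖ, Lsharp, Lflat, .flat, ξ, hf, hϖ, hSP, hEC, h, hι⟩
  -- corank zero: (conv₀), the cyclotomic setting, the local lift (PROVED), a Honda system
  have hp3 : p = 3 := hX.1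
  subst hp3
  have hp2 : (3 : ℕ) ≠ 2 := by decide
  have hgood : W.HasGoodReductionAtPrime 3 := hX.2.1.1
  have hdvd : ((3 : ℕ) : ℤ) ∣ W.frobeniusTrace 3 := hX.2.1.2
  have hL : W.entireLFunction 1 ≠ 0 := hK2 W 3 hX hfin
  haveI : NeZero N := hN
  obtain ⟨κ, hκ, γ, hγ, hγ'⟩ := exists_isCyclotomic_isTopGenerator_isCyclotomicVariable_holds 3
  obtain ⟨v, hv⟩ := exists_heightOneSpectrum_natCast_mem_rat'' 3 (by norm_num)
  obtain ⟨g, hg⟩ := sprungLocalLift_holds 3 κ γ hκ hγ v hv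
  obtain ⟨cneg, c, hc⟩ := h22 W 3 hp2 hgood hdvd κ γ hκ hγ hγ' v hv g hg
  -- both colours are non-zero at `L(E,1) ≠ 0` (Prop. 6.14): take colour ♭
  have hL0 : chromaticL .flat Lsharp Lflat ≠ 0 := by
    rw [chromaticL_flat]
    exact (sharp_ne_zero_and_flat_ne_zero_of_entireLFunction_one_ne_zero hp2 hf hgood hdvd hSP hL).2
  -- the real `X^♭(E/ℚ_∞)`, its generator from K1, cotorsion from Thm. 7.14, the unit from K3
  set D := sharpFlatSelmerDualData W κ (closureEmb (K := ℚ) (v.adicCompletion ℚ)) (W.frobeniusTrace 3)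
    g c .flat hγ with hD
  obtain ⟨gen, h, hchar, hι⟩ :=
    hK1 W 3 hX .flat κ γ hκ hγ hγ' v hv g hg cneg c hc N hN f ϖ Lsharp Lflat hf hϖ hSP hL0 D
  obtain ⟨hfinD, htorD⟩ := h714 W 3 hp2 hgood hdvd f hf κ γ hκ hγ hγ' v hv g hg cneg c hc .flat
    Lsharp Lflat hSP hL0 D
  haveI := hfinD
  obtain ⟨u, hu⟩ := hK3 W 3 hp2 hgood hdvd hL κ γ hκ hγ hγ' v hv g hg cneg c hc .flat D htorD gen
    hchar hfin
  exact ⟨N, hN, f, ϖ, Lsharp, Lflat, .flat, gen, hf, hϖ, hSP, fun _ => ⟨u, hu⟩, h, hι⟩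

end Glue

end Summit.BirchSwinnertonDyer.BirchSwinnertonDyer.Theorems

end
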